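import Summits.BirchSwinnertonDyer.BirchSwinnertonDyer.Theorems.PrintCFramBottomClassIndexLawFiveLeGenusInternalRoutingSupply
import HarnessLib

/-!
# Crux `PrintCFram.BottomClassIndexLawFiveLe` (stmt-BirchSwinnertonDyer-20372), line `eisenstein-resource-bdp-line` (registry v26):
# THE W-STEP WITH THE DISJUNCTION «Stub C ∨ genus-internal datum» — routing kit for the genus-internal branch, part 2b (§2–§3)
# (cell `bsd-print-cfram`, width seat `bsd-line-cfram-p1-w2` g14; THEOREMS ONLY, `--supports` 20372; BSD is not proved by any of this)

HONEST FRAMING. Continuation of `…GenusInternalRoutingSupply` (read its header; split only for the 400-line rule). §2 is THE W-STEP of the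
routing: for every class member `W` (CM, `p ≥ 5` CM-ramified, `r_an = 1`) with odd datum `(f, ψ, ω)`, `hss` and a UNIT class factor, EITHER
Stub C's conclusion OR the GENUS-INTERNAL DATUM (`p = 7`, a globally minimal `W₁ ∼ W` with `C • cm7^{(d_K)} = W₁`, `r_an(W₁) = 1`,
`K = ℚ(√e)` imaginary quadratic of discriminant `d_K ∈ {e, 4e}` `< −4` — either parity —, `7 ∤ d_K`, `7` split in `K`, a cusp-exceptional
prime of `d_K`, Kronecker character `ε_K`, `7 ∤ B_{5,ε_K}/5`), from `(P⁶)` on the class data off the carve-out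
`¬(p = 7 ∧ χ(−1) = −1 ∧ χ(7) = 1)`; the bridge is part 1's class datum with its twisting presentation
(`GenusInternalRouting.exists_krizLiDataDict_of_cmRamified_seven`, p704258) read through the dictionary (odd level: `χ₄` and reciprocity;
even level: part 2a §0 and `OffLocusDictionary.isKroneckerCharacterOf_kroneckerFourPadic`). §3 composes with part 2a §1:
(AtP⁶) ∧ (CuspSeed⁶) ∧ (SeedOffExc⁶ WITH THE CARVE-OUT) ⟹ «Stub C ∨ genus-internal datum» member-wise — the analytic-side socket of a
registry in which `stub_seedOffExc` carries the carve-out; part 3 (`…GenusInternalRoutingEndState`) feeds v18's B2′ slot with it and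
discharges the genus-internal side by w7 g7's `GenusInternal.bsdp_twist_cm7_of_regular_kronecker` (p703735). beyond-print theorem: NO.
References: [KrizLi2019] Thm. 1.20 (pp. 7–8), §8 (pp. 49–52); [Cox2013] §1.C Lemma 1.14; [Washington1997] Thm. 5.11, Cor. 5.13;
registry `Cruxes/BottomClassIndexLawFiveLe/Lines/eisenstein_resource_bdp_line.lean`.
-/

set_option autoImplicit false
-- summit-side namespace `Summit.BirchSwinnertonDyer.BirchSwinnertonDyer.…` (single-conjunct summit, D-0017 layout)
set_option linter.dupNamespace false

noncomputable section

open scoped Classical NumberTheorySymbols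
open NumberField WeierstrassCurve DirichletCharacter Literature.NumberTheory.LFunctions
  Literature.NumberTheory.EllipticCurves Literature.NumberTheory.EllipticCurves.KrizLi2019
  Literature.NumberTheory.EllipticCurves.Rank1Residual
open Literature.NumberTheory.Congruences Literature.NumberTheory.QuadraticFields

namespace Summit.BirchSwinnertonDyer.BirchSwinnertonDyer.Theorems.PrintCFram.GenusInternalRouting

open Summit.BirchSwinnertonDyer.BirchSwinnertonDyer.Theorems.PrintCFram
open Summit.BirchSwinnertonDyer.BirchSwinnertonDyer.Theorems.PrintCFram.KummerDictionary
open Summit.BirchSwinnertonDyer.BirchSwinnertonDyer.Theorems.PrintCFram.HeegnerFieldSupply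
open Summit.BirchSwinnertonDyer.Rank1Residual Summit.BirchSwinnertonDyer.Rank1Residual.X12.O11

/-! ## §2 The W-step with the disjunction «Stub C ∨ genus-internal datum» -/

/-- **THE W-STEP: Stub C's conclusion OR the genus-internal datum, for every class member with a unit class factor, from `(P⁶)` on the
non-carved class data.** Let `W/ℚ` be globally minimal with CM, `p ≥ 5` CM-ramified, `r_an(W) = 1`, with an odd datum `(f, ψ, ω)`, the
trace congruence `hss` and a UNIT class factor `‖B_{1,ψ⁻¹}‖_p > p⁻¹`. Take the class datum `(m, χ, ε, k)` (w3 g2; at `p = 7` part 1's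
version with the twisting presentation `W ∼ W₁`, `C • W₁ = cm7^{(e)}`). If `p = 7`, `m` is odd, `χ(−1) = −1`, `χ(7) = 1` and `m` has a
cusp-exceptional prime, the dictionary gives `e < 0`, `e ≡ 1 (mod 4)`, `m = |e|`, `J(e | 7) = 1`, `k = 2`: the field `K` of discriminant
`e` is imaginary quadratic, `7` splits in it, its Kronecker character `ε_K = (· | |e|)` has the same values as `χ`, so
`B_{5,ε_K} = B_{5,χ}` and the unit class factor (Kummer dictionary, w8 g3) is `7 ∤ B_{5,ε_K}/5` — the GENUS-INTERNAL DATUM. Otherwise the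
side condition of §1 holds at the datum and `(P⁶)` hands an admissible Heegner field with unit field factor, read back on the binders by
the Kummer dictionary exactly as in w8 g4's `stubC_of_splitPrimes_bernoulliUnit_six`. [cite: KrizLi2019, Thm. 1.20 (p. 8) and §8 (pp. 49–52)]
[cite: Washington1997, Thm. 5.11 and Cor. 5.13] [cite: Cox2013, §1.C Lemma 1.14] -/
theorem stubC_or_twistingField_of_splitPrimes_six_offGI
    (hP : ∀ (p : ℕ) [Fact p.Prime] (m : ℕ) [NeZero m] (χ : DirichletCharacter ℚ_[p] m) (k : ℕ),
      (p = 7 ∨ p = 11 ∨ p = 19 ∨ p = 43 ∨ p = 67 ∨ p = 163) →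
      m.Coprime p → χ.IsPrimitive → χ.IsQuadratic → (k = (p + 1) / 4 ∨ k = (3 * p - 1) / 4) →
      2 ≤ k → k ≤ p - 2 → χ (-1) * (-1) ^ k = -1 →
      (p = 7 → χ (-1) = -1 → χ (7 : ZMod m) = 1 → ¬ (∃ ℓ : ℕ, ℓ.Prime ∧ ℓ ∣ m ∧ (ℓ % p = 1 ∨ ℓ % p = p - 1))) →
      ¬ ‖((p - k : ℕ) : ℚ_[p])⁻¹ * generalizedBernoulli (p - k) χ‖ ≤ (p : ℝ)⁻¹ →
      ∃ (K : Type) (_ : Field K) (_ : NumberField K) (εK : DirichletCharacter ℚ_[p] (NumberField.discr K).natAbs),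
        IsImaginaryQuadratic K ∧
        (∀ q : ℕ, q.Prime → q ∣ p * m → ((Ideal.span {(q : ℤ)}).primesOver (𝓞 K)).ncard = 2) ∧
        Odd (NumberField.discr K) ∧ NumberField.discr K < -4 ∧ IsKroneckerCharacterOf K εK ∧
        ¬ ‖(k : ℚ_[p])⁻¹ * @generalizedBernoulli ℚ_[p] _ _
            (changeLevel (dvd_mul_right m (NumberField.discr K).natAbs) χ *
              changeLevel (dvd_mul_left (NumberField.discr K).natAbs m) εK).conductor ⟨conductor_ne_zero _⟩ k
            (changeLevel (dvd_mul_right m (NumberField.discr K).natAbs) χ *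
              changeLevel (dvd_mul_left (NumberField.discr K).natAbs m) εK).primitiveCharacter‖ ≤ (p : ℝ)⁻¹) :
    ∀ (W : WeierstrassCurve ℚ) [W.IsElliptic] [W.IsGloballyMinimal] (p : ℕ) [Fact p.Prime], W.HasCM → CMRamified W p → 5 ≤ p →
      W.analyticRank = 1 → ∀ (f : ℕ) [NeZero f] (ψ : DirichletCharacter ℚ_[p] f) (ω : DirichletCharacter ℚ_[p] p), ψ.Odd →
      IsTeichmullerCharacter ω →
      (∀ ℓ : ℕ, ℓ.Prime → ¬ (ℓ ∣ p * W.conductorNorm ℤ) →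
        ‖((W.LFunction ℓ : ℤ) : ℚ_[p]) - (ψ (ℓ : ZMod f) + ψ⁻¹ (ℓ : ZMod f) * ω (ℓ : ZMod p))‖ < 1) →
      ¬ ‖bernoulliOnePrim ψ⁻¹‖ ≤ (p : ℝ)⁻¹ →
      (∃ (K : Type) (_ : Field K) (_ : NumberField K) (εK : DirichletCharacter ℚ_[p] (NumberField.discr K).natAbs),
        IsImaginaryQuadratic K ∧ SatisfiesHeegnerHypothesis (W.conductorNorm ℤ) K ∧ Odd (NumberField.discr K) ∧
        NumberField.discr K < -4 ∧ IsKroneckerCharacterOf K εK ∧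
        ¬ ‖bernoulliOnePrim (bernoulliCharTwo ψ εK ω)‖ ≤ (p : ℝ)⁻¹) ∨
      (p = 7 ∧ ∃ (W₁ : WeierstrassCurve ℚ) (_ : W₁.IsElliptic) (_ : W₁.IsGloballyMinimal)
        (K : Type) (_ : Field K) (_ : NumberField K) (εK : DirichletCharacter ℚ_[p] (NumberField.discr K).natAbs),
        IsIsogenous W W₁ ∧ W₁.analyticRank = 1 ∧ IsImaginaryQuadratic K ∧ SatisfiesHeegnerHypothesis (p ^ 2) K ∧
        NumberField.discr K < -4 ∧ IsKroneckerCharacterOf K εK ∧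
        (NumberField.discr K).natAbs.Coprime p ∧
        (∃ ℓ : ℕ, ℓ.Prime ∧ (ℓ : ℤ) ∣ NumberField.discr K ∧ (ℓ % p = 1 ∨ ℓ % p = p - 1)) ∧
        ¬ ‖((p - 2 : ℕ) : ℚ_[p])⁻¹ * generalizedBernoulli (p - 2) εK‖ ≤ (p : ℝ)⁻¹ ∧
        ∃ C : VariableChange ℚ, C • cm7.quadraticTwist ((NumberField.discr K : ℤ) : ℚ) = W₁) := by
  intro W _ _ p hp hCM hram h5 hr f _ ψ ω hψ hω hss hcls
  have hp6 : p = 7 ∨ p = 11 ∨ p = 19 ∨ p = 43 ∨ p = 67 ∨ p = 163 := (X12.eq_of_dvd_cmFieldDiscrOfJ W hCM hp.out h5 hram).1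
  by_cases hp7 : p = 7
  · subst hp7
    obtain ⟨m, hm, χ, ε, k, e, W₁, hW₁E, hW₁M, C, ⟨hmp, hχ, hχq, hε, hk, hk2, hkp, hpar, htr, hgoodW⟩,
        ⟨hsq, hpe, hiso, hC⟩, hdict, hodd⟩ :=
      GenusInternalRouting.exists_krizLiDataDict_of_cmRamified_seven W hCM hram
    haveI := hm
    have hclsB : ¬ ‖((7 - k : ℕ) : ℚ_[7])⁻¹ * generalizedBernoulli (7 - k) χ‖ ≤ ((7 : ℕ) : ℝ)⁻¹ := fun h ↦
      hcls ((norm_bernoulliOnePrim_inv_le_inv_iff_of_hss W χ ε k ω ψ h5 hχ hχq hmp (fun ℓ _ _ ↦ hε ℓ) hk2 hkp hpar htr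
        hgoodW hω hψ hss).mpr h)
    by_cases hGI : χ (-1) = -1 ∧ χ (7 : ZMod m) = 1 ∧ (∃ ℓ : ℕ, ℓ.Prime ∧ ℓ ∣ m ∧ (ℓ % 7 = 1 ∨ ℓ % 7 = 7 - 1))
    · /- THE GENUS-INTERNAL DATUM -/
      right
      obtain ⟨hneg, hsev, ⟨ℓ, hℓ, hℓm, hℓ7⟩⟩ := hGI
      -- the exponent is `k = 2`
      have hk' : k = (7 + 1) / 4 := by
        rcases hk with h | h
        · exact h
        · exfalso
          rw [h, hneg] at hpar
          norm_num at hpar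
      subst hk'
      have e52 : (7 : ℕ) - (7 + 1) / 4 = 7 - 2 := by norm_num
      rw [e52] at hclsB
      -- the exceptional prime `ℓ` is odd, `≥ 5`, and divides `|e|`
      have hℓ5 : 5 ≤ ℓ := by have := hℓ.two_le; omega
      have hℓ2 : ℓ ≠ 2 := by omega
      have hℓcop4 : ℓ.Coprime 4 := by
        rw [show (4 : ℕ) = 2 ^ 2 by norm_num]
        exact ((Nat.coprime_primes hℓ Nat.prime_two).mpr hℓ2).pow_right 2
      have hr₁ : W₁.analyticRank = 1 := by rw [← analyticRank_eq_of_isIsogenous' hiso]; exact hr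
      rcases hdict with ⟨he4, hme, hεJ⟩ | ⟨he4', hme, hεK4⟩
      · /- ODD twisting parameter `e ≡ 1 (mod 4)`: `K = ℚ(√e)`, `d_K = e` -/
        have hm2 : ¬ 2 ∣ m := by
          rw [hme, Nat.two_dvd_ne_zero, ← Nat.odd_iff, Int.natAbs_odd, Int.odd_iff]; omega
        obtain ⟨hlt, hJ⟩ := hodd hm2
        have he0 : e < 0 := hlt hneg
        have hJ7 : J(e | 7) = 1 := hJ hsev
        have hne : (e.natAbs : ℤ) = -e := Int.ofNat_natAbs_of_nonpos he0.le
        have hn3 : e.natAbs % 4 = 3 := by omega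
        have hsqn : Squarefree e.natAbs := Int.squarefree_natAbs.mpr hsq
        obtain ⟨K, iF, iN, h2, hd⟩ := Quadratic.exists_numberField_discr_eq (D := e) (Or.inl ⟨he4, hsq, by omega⟩)
        have hK : IsImaginaryQuadratic K := isImaginaryQuadratic_of_discr_eq_of_neg h2 hd he0
        have hdn : (NumberField.discr K).natAbs = e.natAbs := by rw [hd]
        have hde : NumberField.discr K = -(e.natAbs : ℤ) := by rw [hd, hne, neg_neg]
        obtain ⟨εK, hεK, hεKv⟩ :=
          KrizLiBinders.exists_isKroneckerCharacterOf_of_discr (p := 7) h2 (m := e.natAbs) hsqn (Or.inr ⟨hde, hn3⟩)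
        have hℓe : ℓ ∣ e.natAbs := hme ▸ hℓm
        have hℓle : ℓ ≤ e.natAbs := Nat.le_of_dvd (Int.natAbs_pos.mpr hsq.ne_zero) hℓe
        refine ⟨rfl, W₁, hW₁E, hW₁M, K, iF, iN, εK, hiso, hr₁, hK, ?_, ?_, hεK, ?_, ⟨ℓ, hℓ, ?_, hℓ7⟩, ?_, ⟨C⁻¹, ?_⟩⟩
        · -- Heegner for `7²`: `7` splits in `K` since `J(e | 7) = 1`
          intro q hq hq49
          have hq7 : q = 7 := (Nat.prime_dvd_prime_iff_eq hq (by norm_num)).mp (hq.dvd_of_dvd_pow hq49)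
          subst hq7
          rw [Quadratic.ncard_primesOver_eq_two_iff_jacobiSym h2 hq (by norm_num), hd]
          exact hJ7
        · -- `d_K < −4`
          have hℓle' : (ℓ : ℤ) ≤ (e.natAbs : ℤ) := by exact_mod_cast hℓle
          have hℓ5' : (5 : ℤ) ≤ (ℓ : ℤ) := by exact_mod_cast hℓ5
          rw [hd]; omega
        · -- `7 ∤ d_K`
          rw [hdn, ← hme]; exact hmp
        · -- the exceptional prime divides `d_K`
          rw [hd]; exact Int.natCast_dvd.mpr hℓe
        · -- regularity transported to `ε_K`: same values `(· | |e|)` as `χ`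
          have hB : generalizedBernoulli (7 - 2) εK = generalizedBernoulli (7 - 2) χ :=
            generalizedBernoulli_eq_of_forall_apply_natCast_eq (hdn.trans hme.symm) εK χ
              (fun a ↦ by rw [hεKv a, hε a, hεJ a]) (7 - 2)
          rwa [hB]
        · -- `C⁻¹ • cm7^{(d_K)} = W₁`
          rw [hd, ← hC, inv_smul_smul]
      · /- EVEN twisting parameter `e ≡ 2, 3 (mod 4)`: `K = ℚ(√e)`, `d_K = 4e` -/
        have he0 : e < 0 :=
          neg_of_kroneckerFour_apply_neg_one (p := 7) he4' hme (χ := χ) (fun a ↦ by rw [hε a, hεK4 a]) hneg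
        have hJ7 : J(e | 7) = 1 := by
          have h7v : χ ((7 : ℕ) : ZMod m) = (J(e | 7) : ℚ_[7]) := by
            rw [hε 7, hεK4 7, if_neg (by decide)]
          have : (J(e | 7) : ℚ_[7]) = 1 := by rw [← h7v]; simpa using hsev
          exact_mod_cast this
        obtain ⟨K, iF, iN, h2, hd⟩ := Quadratic.exists_numberField_discr_eq (D := 4 * e)
          (Or.inr ⟨dvd_mul_right 4 e, by rw [Int.mul_ediv_cancel_left _ (by norm_num)]; exact he4',
            by rw [Int.mul_ediv_cancel_left _ (by norm_num)]; exact hsq⟩)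
        have hK : IsImaginaryQuadratic K := isImaginaryQuadratic_of_discr_eq_of_neg h2 hd (by omega)
        have hdn : (NumberField.discr K).natAbs = 4 * e.natAbs := by rw [hd, Int.natAbs_mul]; rfl
        haveI : NeZero (NumberField.discr K).natAbs := ⟨by rw [hdn, ← hme]; exact NeZero.ne m⟩
        obtain ⟨εK, hεKv⟩ := KrizLiBinders.exists_kroneckerFourPadic (p := 7) e hsq.ne_zero hdn
        have hεKp : εK.IsPrimitive := KrizLiBinders.isPrimitive_of_forall_eq_kroneckerFour' hdn he4' hsq hεKv
        have hεK : IsKroneckerCharacterOf K εK := by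
          have h := OffLocusDictionary.isKroneckerCharacterOf_kroneckerFourPadic (p := 7) h2 hd εK hεKp
            (fun a ha ↦ KrizLiBinders.apply_eq_jacobiSym_of_odd hεKv a ha) hdn dvd_rfl
          rwa [changeLevel_self] at h
        have hℓe : ℓ ∣ e.natAbs := hℓcop4.dvd_of_dvd_mul_left (hme ▸ hℓm)
        have hℓle : ℓ ≤ e.natAbs := Nat.le_of_dvd (Int.natAbs_pos.mpr hsq.ne_zero) hℓe
        have hne : (e.natAbs : ℤ) = -e := Int.ofNat_natAbs_of_nonpos he0.le
        -- `cm7^{(4e)} = C₂ • cm7^{(e)}`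
        obtain ⟨C₂, hC₂⟩ := cm7.exists_variableChange_quadraticTwist_mul_sq (e : ℚ) 2 two_ne_zero
        have hC₂' : cm7.quadraticTwist (((4 * e : ℤ)) : ℚ) = C₂ • cm7.quadraticTwist (e : ℚ) := by
          rw [hC₂]; push_cast; congr 1; ring
        refine ⟨rfl, W₁, hW₁E, hW₁M, K, iF, iN, εK, hiso, hr₁, hK, ?_, ?_, hεK, ?_, ⟨ℓ, hℓ, ?_, hℓ7⟩, ?_, ⟨(C₂ * C)⁻¹, ?_⟩⟩
        · -- Heegner for `7²`: `J(4e | 7) = J(e | 7) = 1`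
          intro q hq hq49
          have hq7 : q = 7 := (Nat.prime_dvd_prime_iff_eq hq (by norm_num)).mp (hq.dvd_of_dvd_pow hq49)
          subst hq7
          rw [Quadratic.ncard_primesOver_eq_two_iff_jacobiSym h2 hq (by norm_num), hd, jacobiSym.mul_left, hJ7, mul_one]
          norm_num
        · -- `d_K = 4e < −4`
          have hℓle' : (ℓ : ℤ) ≤ (e.natAbs : ℤ) := by exact_mod_cast hℓle
          have hℓ5' : (5 : ℤ) ≤ (ℓ : ℤ) := by exact_mod_cast hℓ5
          rw [hd]; omega
        · -- `7 ∤ d_K`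
          rw [hdn, ← hme]; exact hmp
        · -- the exceptional prime divides `d_K = 4e`
          rw [hd]; exact (Int.natCast_dvd.mpr hℓe).mul_left 4
        · -- regularity transported to `ε_K`: same values `[· odd]·(e | ·)` as `χ`
          have hB : generalizedBernoulli (7 - 2) εK = generalizedBernoulli (7 - 2) χ :=
            generalizedBernoulli_eq_of_forall_apply_natCast_eq (hdn.trans hme.symm) εK χ
              (fun a ↦ by rw [hεKv a, hε a, hεK4 a]) (7 - 2)
          rwa [hB]
        · -- `(C₂ C)⁻¹ • cm7^{(4e)} = W₁`
          rw [hd, hC₂', ← hC, smul_smul, smul_smul, mul_assoc, inv_mul_cancel, one_smul]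
    · /- not genus-internal: the seed road, the carve-out's side condition holds at the datum -/
      left
      have hGIoff : (7 : ℕ) = 7 → χ (-1) = -1 → χ (7 : ZMod m) = 1 →
          ¬ (∃ ℓ : ℕ, ℓ.Prime ∧ ℓ ∣ m ∧ (ℓ % 7 = 1 ∨ ℓ % 7 = 7 - 1)) :=
        fun _ h2 h3 h4 ↦ hGI ⟨h2, h3, h4⟩
      obtain ⟨K, iK, iK', εK, hK, hsplit, hoddK, hd4, hεK, hfld⟩ :=
        hP 7 m χ k hp6 hmp hχ hχq hk hk2 hkp hpar hGIoff hclsB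
      have hH : SatisfiesHeegnerHypothesis (W.conductorNorm ℤ) K :=
        satisfiesHeegnerHypothesis_of_split_of_classData W hgoodW K hsplit
      refine ⟨K, iK, iK', εK, hK, hH, hoddK, hd4, hεK, fun h ↦ hfld ?_⟩
      exact (norm_bernoulliOnePrim_bernoulliCharTwo_le_inv_iff_of_heegner W χ ε k ω ψ hCM hram h5 hχ hχq hmp (fun ℓ _ _ ↦ hε ℓ)
        hk2 hkp hpar htr hgoodW hω hψ hss K hK hH εK).mp h
  · /- `p ≠ 7`: the seed road, the side condition is vacuous -/
    left
    obtain ⟨m, hm, χ, ε, k, hmp, hχ, hχq, hε, hk, hk2, hkp, hpar, htr, hgoodW⟩ :=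
      KrizLiBinders.exists_krizLiData_of_cmRamified W hCM hram h5
    haveI := hm
    have hclsB : ¬ ‖((p - k : ℕ) : ℚ_[p])⁻¹ * generalizedBernoulli (p - k) χ‖ ≤ (p : ℝ)⁻¹ := fun h ↦
      hcls ((norm_bernoulliOnePrim_inv_le_inv_iff_of_hss W χ ε k ω ψ h5 hχ hχq hmp (fun ℓ _ _ ↦ hε ℓ) hk2 hkp hpar htr
        hgoodW hω hψ hss).mpr h)
    obtain ⟨K, iK, iK', εK, hK, hsplit, hoddK, hd4, hεK, hfld⟩ :=
      hP p m χ k hp6 hmp hχ hχq hk hk2 hkp hpar (fun h ↦ absurd h hp7) hclsB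
    have hH : SatisfiesHeegnerHypothesis (W.conductorNorm ℤ) K :=
      satisfiesHeegnerHypothesis_of_split_of_classData W hgoodW K hsplit
    refine ⟨K, iK, iK', εK, hK, hH, hoddK, hd4, hεK, fun h ↦ hfld ?_⟩
    exact (norm_bernoulliOnePrim_bernoulliCharTwo_le_inv_iff_of_heegner W χ ε k ω ψ hCM hram h5 hχ hχq hmp (fun ℓ _ _ ↦ hε ℓ)
      hk2 hkp hpar htr hgoodW hω hψ hss K hK hH εK).mp h

/-! ## §3 The composition: (AtP⁶) ∧ (CuspSeed⁶) ∧ (SeedOffExc⁶ with the carve-out) ⟹ «Stub C ∨ genus-internal datum» -/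

/-- **«Stub C ∨ GENUS-INTERNAL DATUM» member-wise ⟸ (AtP⁶) ∧ (CuspSeed⁶) ∧ (SeedOffExc⁶ WITH THE CARVE-OUT `¬(p = 7 ∧ ¬2∣m ∧ χ(−1) = −1 ∧
χ(7) = 1)`)** — §2 ∘ §1. This is the analytic-side socket of a registry in which `stub_seedOffExc` carries the carve-out and the carved
members are paid by the genus-internal branch (`BSD_7` for the twists of `cm7` by their own imaginary twisting field, Kriz–Li Thm 1.20 at
`(X₀(49), 7, ω²)`); part 3 feeds v18's B2′ slot with it. (AtP⁶) and (CuspSeed⁶) are print by name (LEAD g13 p695510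
`CutFormAssembly.atP_six_of_facts`, w8 g8 p702371 `CuspGlue.cuspSeed_six_of_facts`). BSD is not proved by any of this; no stub is closed.
[cite: KrizLi2019, Thm. 1.20 (p. 8) and §8 (pp. 49–52)] [cite: Cohen1975, Thm. 3.1] [cite: AhlgrenBoylan2003, Thm. 3] -/
theorem stubC_or_twistingField_of_atP_of_cuspSeed_of_excOffGI
    (hAt : ∀ (p : ℕ) [Fact p.Prime] (m : ℕ) [NeZero m] (χ : DirichletCharacter ℚ_[p] m) (k : ℕ),
      (p = 7 ∨ p = 11 ∨ p = 19 ∨ p = 43 ∨ p = 67 ∨ p = 163) →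
      m.Coprime p → χ.IsPrimitive → χ.IsQuadratic → (k = (p + 1) / 4 ∨ k = (3 * p - 1) / 4) →
      2 ≤ k → k ≤ p - 2 → χ (-1) * (-1) ^ k = -1 →
      (∃ (K₀ : Type) (_ : Field K₀) (_ : NumberField K₀) (ε₀ : DirichletCharacter ℚ_[p] (NumberField.discr K₀).natAbs),
        IsImaginaryQuadratic K₀ ∧
        (∀ q : ℕ, q.Prime → q ∣ m → ((Ideal.span {(q : ℤ)}).primesOver (𝓞 K₀)).ncard = 2) ∧
        Odd (NumberField.discr K₀) ∧ NumberField.discr K₀ < -4 ∧ IsKroneckerCharacterOf K₀ ε₀ ∧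
        ¬ ‖(k : ℚ_[p])⁻¹ * @generalizedBernoulli ℚ_[p] _ _
            (changeLevel (dvd_mul_right m (NumberField.discr K₀).natAbs) χ *
              changeLevel (dvd_mul_left (NumberField.discr K₀).natAbs m) ε₀).conductor ⟨conductor_ne_zero _⟩ k
            (changeLevel (dvd_mul_right m (NumberField.discr K₀).natAbs) χ *
              changeLevel (dvd_mul_left (NumberField.discr K₀).natAbs m) ε₀).primitiveCharacter‖ ≤ (p : ℝ)⁻¹) →
      ∃ (K : Type) (_ : Field K) (_ : NumberField K) (εK : DirichletCharacter ℚ_[p] (NumberField.discr K).natAbs),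
        IsImaginaryQuadratic K ∧
        (∀ q : ℕ, q.Prime → q ∣ p * m → ((Ideal.span {(q : ℤ)}).primesOver (𝓞 K)).ncard = 2) ∧
        Odd (NumberField.discr K) ∧ NumberField.discr K < -4 ∧ IsKroneckerCharacterOf K εK ∧
        ¬ ‖(k : ℚ_[p])⁻¹ * @generalizedBernoulli ℚ_[p] _ _
            (changeLevel (dvd_mul_right m (NumberField.discr K).natAbs) χ *
              changeLevel (dvd_mul_left (NumberField.discr K).natAbs m) εK).conductor ⟨conductor_ne_zero _⟩ k
            (changeLevel (dvd_mul_right m (NumberField.discr K).natAbs) χ *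
              changeLevel (dvd_mul_left (NumberField.discr K).natAbs m) εK).primitiveCharacter‖ ≤ (p : ℝ)⁻¹)
    (hCusp : ∀ (p : ℕ) [Fact p.Prime] (m : ℕ) [NeZero m] (χ : DirichletCharacter ℚ_[p] m) (k : ℕ),
      (p = 7 ∨ p = 11 ∨ p = 19 ∨ p = 43 ∨ p = 67 ∨ p = 163) →
      m.Coprime p → χ.IsPrimitive → χ.IsQuadratic → (k = (p + 1) / 4 ∨ k = (3 * p - 1) / 4) →
      2 ≤ k → k ≤ p - 2 → χ (-1) * (-1) ^ k = -1 →
      ¬ (∃ ℓ : ℕ, ℓ.Prime ∧ ℓ ∣ m ∧ (ℓ % p = 1 ∨ ℓ % p = p - 1)) →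
      ∃ (K₀ : Type) (_ : Field K₀) (_ : NumberField K₀) (ε₀ : DirichletCharacter ℚ_[p] (NumberField.discr K₀).natAbs),
        IsImaginaryQuadratic K₀ ∧
        (∀ q : ℕ, q.Prime → q ∣ m → ((Ideal.span {(q : ℤ)}).primesOver (𝓞 K₀)).ncard = 2) ∧
        Odd (NumberField.discr K₀) ∧ NumberField.discr K₀ < -4 ∧ IsKroneckerCharacterOf K₀ ε₀ ∧
        ¬ ‖(k : ℚ_[p])⁻¹ * @generalizedBernoulli ℚ_[p] _ _
            (changeLevel (dvd_mul_right m (NumberField.discr K₀).natAbs) χ *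
              changeLevel (dvd_mul_left (NumberField.discr K₀).natAbs m) ε₀).conductor ⟨conductor_ne_zero _⟩ k
            (changeLevel (dvd_mul_right m (NumberField.discr K₀).natAbs) χ *
              changeLevel (dvd_mul_left (NumberField.discr K₀).natAbs m) ε₀).primitiveCharacter‖ ≤ (p : ℝ)⁻¹)
    (hExcGI : ∀ (p : ℕ) [Fact p.Prime] (m : ℕ) [NeZero m] (χ : DirichletCharacter ℚ_[p] m) (k : ℕ),
      (p = 7 ∨ p = 11 ∨ p = 19 ∨ p = 43 ∨ p = 67 ∨ p = 163) →
      m.Coprime p → χ.IsPrimitive → χ.IsQuadratic → (k = (p + 1) / 4 ∨ k = (3 * p - 1) / 4) →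
      2 ≤ k → k ≤ p - 2 → χ (-1) * (-1) ^ k = -1 →
      ¬ ((∀ q : ℕ, q.Prime → q ∣ m → q ≠ 2 → jacobiSym (-(p : ℤ)) q = 1) ∧ (2 ∣ m → p % 8 = 7)) →
      (∃ ℓ : ℕ, ℓ.Prime ∧ ℓ ∣ m ∧ (ℓ % p = 1 ∨ ℓ % p = p - 1)) →
      ¬ (p = 7 ∧ χ (-1) = -1 ∧ χ (7 : ZMod m) = 1) →
      ¬ ‖((p - k : ℕ) : ℚ_[p])⁻¹ * generalizedBernoulli (p - k) χ‖ ≤ (p : ℝ)⁻¹ →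
      ∃ (K₀ : Type) (_ : Field K₀) (_ : NumberField K₀) (ε₀ : DirichletCharacter ℚ_[p] (NumberField.discr K₀).natAbs),
        IsImaginaryQuadratic K₀ ∧
        (∀ q : ℕ, q.Prime → q ∣ m → ((Ideal.span {(q : ℤ)}).primesOver (𝓞 K₀)).ncard = 2) ∧
        Odd (NumberField.discr K₀) ∧ NumberField.discr K₀ < -4 ∧ IsKroneckerCharacterOf K₀ ε₀ ∧
        ¬ ‖(k : ℚ_[p])⁻¹ * @generalizedBernoulli ℚ_[p] _ _
            (changeLevel (dvd_mul_right m (NumberField.discr K₀).natAbs) χ *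
              changeLevel (dvd_mul_left (NumberField.discr K₀).natAbs m) ε₀).conductor ⟨conductor_ne_zero _⟩ k
            (changeLevel (dvd_mul_right m (NumberField.discr K₀).natAbs) χ *
              changeLevel (dvd_mul_left (NumberField.discr K₀).natAbs m) ε₀).primitiveCharacter‖ ≤ (p : ℝ)⁻¹) :
    ∀ (W : WeierstrassCurve ℚ) [W.IsElliptic] [W.IsGloballyMinimal] (p : ℕ) [Fact p.Prime], W.HasCM → CMRamified W p → 5 ≤ p →
      W.analyticRank = 1 → ∀ (f : ℕ) [NeZero f] (ψ : DirichletCharacter ℚ_[p] f) (ω : DirichletCharacter ℚ_[p] p), ψ.Odd →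
      IsTeichmullerCharacter ω →
      (∀ ℓ : ℕ, ℓ.Prime → ¬ (ℓ ∣ p * W.conductorNorm ℤ) →
        ‖((W.LFunction ℓ : ℤ) : ℚ_[p]) - (ψ (ℓ : ZMod f) + ψ⁻¹ (ℓ : ZMod f) * ω (ℓ : ZMod p))‖ < 1) →
      ¬ ‖bernoulliOnePrim ψ⁻¹‖ ≤ (p : ℝ)⁻¹ →
      (∃ (K : Type) (_ : Field K) (_ : NumberField K) (εK : DirichletCharacter ℚ_[p] (NumberField.discr K).natAbs),
        IsImaginaryQuadratic K ∧ SatisfiesHeegnerHypothesis (W.conductorNorm ℤ) K ∧ Odd (NumberField.discr K) ∧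
        NumberField.discr K < -4 ∧ IsKroneckerCharacterOf K εK ∧
        ¬ ‖bernoulliOnePrim (bernoulliCharTwo ψ εK ω)‖ ≤ (p : ℝ)⁻¹) ∨
      (p = 7 ∧ ∃ (W₁ : WeierstrassCurve ℚ) (_ : W₁.IsElliptic) (_ : W₁.IsGloballyMinimal)
        (K : Type) (_ : Field K) (_ : NumberField K) (εK : DirichletCharacter ℚ_[p] (NumberField.discr K).natAbs),
        IsIsogenous W W₁ ∧ W₁.analyticRank = 1 ∧ IsImaginaryQuadratic K ∧ SatisfiesHeegnerHypothesis (p ^ 2) K ∧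
        NumberField.discr K < -4 ∧ IsKroneckerCharacterOf K εK ∧
        (NumberField.discr K).natAbs.Coprime p ∧
        (∃ ℓ : ℕ, ℓ.Prime ∧ (ℓ : ℤ) ∣ NumberField.discr K ∧ (ℓ % p = 1 ∨ ℓ % p = p - 1)) ∧
        ¬ ‖((p - 2 : ℕ) : ℚ_[p])⁻¹ * generalizedBernoulli (p - 2) εK‖ ≤ (p : ℝ)⁻¹ ∧
        ∃ C : VariableChange ℚ, C • cm7.quadraticTwist ((NumberField.discr K : ℤ) : ℚ) = W₁) :=
  stubC_or_twistingField_of_splitPrimes_six_offGI (splitPrimes_six_of_atP_of_cuspSeed_of_excOffGI hAt hCusp hExcGI)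

end Summit.BirchSwinnertonDyer.BirchSwinnertonDyer.Theorems.PrintCFram.GenusInternalRouting

end
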